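import Summits.AtomisticToContinuum.HydrodynamicLimit.Theses.RelayRaceLocality
import Literature.MathematicalPhysics.KineticTheory.HardSphereEulerLLN
import Literature.Analysis.FluidPDE.HardSpherePhaseSpaceProofs
import Literature.Analysis.FluidPDE.HardSphereRegularGeometry

/-!
# `LightConeInLaw` (stmt-AtomisticToContinuum-12500), negative side — the stationary shear flow

Part 2/4 (see `IdealGasStatics`). The shear profile `G(s) = expNegInvGlue(-cos 2πs)` (smooth, `1`-periodic, `≥ 0`,
`= 0` iff `|s| ≤ 1/4 mod 1`, `G(1/2) > 0`), the torus field `g(x) = G(x₁)` and the drift `u(x) = g(x) e₀`; the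
stationary state `(ρ, u, θ) = (1, g e₀, 1)` is a classical hard-sphere Euler solution on every `[0, T)` for EVERY
equation of state (`shear_isSolution`: `p` constant, `div u = 0`, `(u·∇)u = 0`, `E = E(x₁)` transported along `e₀`).
Also: Haar integrals on `𝕋³` are invariant under shears along `e₀` whose amplitude does not depend on the coordinate
`0` (`integral_shear`: `𝕋³ ≃ᵐ 𝕋 × 𝕋²` by `piFinSuccAbove`, coordinate `0` innermost, translation invariance on `𝕋`).
refuter-cdisprove-stmt-AtomisticToContinuum-12500-0.
-/

noncomputable section

open MeasureTheory ProbabilityTheory Filter Set Topology Real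
open scoped ENNReal NNReal InnerProductSpace
open Literature.MathematicalPhysics.KineticTheory Literature.Analysis.FluidPDE Literature.Analysis.FunctionSpaces
namespace Summit.AtomisticToContinuum.HydrodynamicLimit.Theorems.LightConeInLawIdealGas

/-! ## B. The stationary shear flow: an inhomogeneous classical Euler solution for EVERY equation of state -/

section Shear

open Literature.Analysis.FunctionSpaces

/-- The shear profile on `ℝ`: `G(s) = expNegInvGlue (-cos 2πs)` — smooth, `1`-periodic, `≥ 0`, zero exactly where
`cos 2πs ≥ 0` (i.e. `|s| ≤ 1/4 mod 1`), positive at `s = 1/2`. [folklore] -/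
def shearG (s : ℝ) : ℝ := expNegInvGlue (-Real.cos (2 * π * s))

/-- The shear profile is `1`-periodic. [folklore] -/
theorem shearG_periodic : Function.Periodic shearG 1 := fun s => by
  simp only [shearG]
  rw [mul_add, mul_one, Real.cos_add_two_pi]

/-- The shear profile is nonnegative. [folklore] -/
theorem shearG_nonneg (s : ℝ) : 0 ≤ shearG s := expNegInvGlue.nonneg _

/-- The shear profile vanishes where `cos 2πs ≥ 0`. [folklore] -/
theorem shearG_eq_zero_of_cos_nonneg {s : ℝ} (h : 0 ≤ Real.cos (2 * π * s)) : shearG s = 0 :=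
  expNegInvGlue.zero_of_nonpos (by linarith)

/-- The shear profile is positive at `s = 1/2`. [folklore] -/
theorem shearG_half_pos : 0 < shearG (1 / 2) := by
  refine expNegInvGlue.pos_of_pos ?_
  rw [show 2 * π * (1 / 2) = π by ring, Real.cos_pi]
  norm_num

/-- The shear profile is smooth. [folklore] -/
theorem contDiff_shearG {n : ℕ∞} : ContDiff ℝ n shearG := by
  have h1 : ContDiff ℝ n (fun s : ℝ => -Real.cos (2 * π * s)) := by fun_prop
  show ContDiff ℝ n (fun s => expNegInvGlue (-Real.cos (2 * π * s)))
  exact expNegInvGlue.contDiff.comp h1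

/-- The shear profile is continuous. [folklore] -/
theorem continuous_shearG : Continuous shearG := (contDiff_shearG (n := 0)).continuous

/-- The shear profile on the torus: `g(x) = G(x₁)` (a function of the SECOND coordinate only). [folklore] -/
def shearT (x : T3) : ℝ := shearG_periodic.lift (x 1)

/-- The torus shear profile lifts to `y ↦ G(y₁)`. [folklore] -/
theorem shearT_proj (y : EuclideanSpace ℝ (Fin 3)) : shearT (Torus.proj y) = shearG (y 1) := by
  rw [shearT, Torus.proj_apply]
  exact shearG_periodic.lift_coe (y 1)

/-- The torus shear profile in terms of the symmetric representative. [folklore] -/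
theorem shearT_eq (x : T3) : shearT x = shearG (Torus.reprSym x 1) := by
  conv_lhs => rw [← Torus.proj_reprSym x]
  exact shearT_proj _

/-- The torus shear profile is nonnegative. [folklore] -/
theorem shearT_nonneg (x : T3) : 0 ≤ shearT x := by
  rw [shearT_eq]; exact shearG_nonneg _


/-- The unit vector `e₀`. -/
def e0 : V3 := EuclideanSpace.single (0 : Fin 3) (1 : ℝ)

/-- `‖e₀‖ = 1`. [folklore] -/
theorem norm_e0 : ‖e0‖ = 1 := by
  rw [e0, EuclideanSpace.single, PiLp.norm_single, norm_one]

/-- The stationary shear drift field `u(x) = G(x₁) e₀`. [folklore] -/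
def shearU (x : T3) : V3 := shearT x • e0

/-- Coordinates of the shear field. [folklore] -/
theorem shearU_apply (x : T3) (i : Fin 3) : shearU x i = shearT x * e0 i := by
  simp [shearU]

/-- `e₀` has first coordinate `1`. [folklore] -/
@[simp] theorem e0_zero : e0 0 = 1 := by simp [e0]
/-- `e₀` has second coordinate `0`. [folklore] -/
@[simp] theorem e0_one : e0 1 = 0 := by simp [e0]
/-- `e₀` has third coordinate `0`. [folklore] -/
@[simp] theorem e0_two : e0 2 = 0 := by simp [e0]

/-- Moving along `e₀` does not change the second coordinate, hence not the shear profile. [folklore] -/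
theorem shearT_add_proj (x : T3) (s : ℝ) :
    shearT (x + Torus.proj (s • EuclideanSpace.single (0 : Fin 3) (1 : ℝ))) = shearT x := by
  simp only [shearT]
  congr 1
  rw [Pi.add_apply, Torus.proj_apply]
  simp

/-- The speed of the shear field is the shear profile. [folklore] -/
theorem norm_shearU (x : T3) : ‖shearU x‖ = shearT x := by
  rw [shearU, norm_smul, norm_e0, mul_one, Real.norm_eq_abs, abs_of_nonneg (shearT_nonneg x)]

/-- **The stationary shear flow is a classical hard-sphere Euler solution for every equation of state** (every
`σ`, every `T`): density `1`, temperature `1`, velocity `G(x₁) e₀` — pressure constant, `div u = 0`,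
`(u·∇)u = 0`, energy a function of `x₁` transported along `e₀`. [folklore] -/
theorem shear_isSolution (σ T : ℝ) :
    IsHardSphereEulerSolution σ T (fun _ _ => 1) (fun _ x => shearU x) (fun _ _ => 1) where
  smooth_density := contDiffOn_const
  smooth_velocity := by
    have h : Torus.stLift (fun (_ : ℝ) (x : T3) => shearU x) =
        fun p : ℝ × EuclideanSpace ℝ (Fin 3) => shearG (p.2 1) • e0 := by
      funext p
      rw [Torus.stLift_apply]
      simp only [shearU, shearT_proj]
    unfold Torus.IsSmoothSpaceTimeOn
    rw [h]
    refine ContDiff.contDiffOn ?_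
    have h1 : ContDiff ℝ ((⊤ : ℕ∞) : WithTop ℕ∞) (fun p : ℝ × EuclideanSpace ℝ (Fin 3) => p.2 1) :=
      (EuclideanSpace.proj (1 : Fin 3) (𝕜 := ℝ)).contDiff.comp contDiff_snd
    exact ((contDiff_shearG (n := ⊤)).comp h1).smul contDiff_const
  smooth_temperature := contDiffOn_const
  density_pos _ _ _ := one_pos
  temperature_pos _ _ _ := one_pos
  mass t _ x := by
    simp only [Torus.timeDerivWithin, Torus.divergence, Torus.partialDeriv, Torus.lineDeriv, derivWithin_fun_const, Pi.zero_apply,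
      Fin.sum_univ_three, one_smul, shearU_apply, e0_zero, e0_one, e0_two, mul_one, mul_zero, deriv_const,
      shearT_add_proj, add_zero]
  momentum t _ x := by
    have hg : Torus.gradient (fun _ : T3 => hsPressure σ 1 1) x = 0 := by
      unfold Torus.gradient Torus.liftAt
      simp [_root_.gradient]
    rw [hg]
    simp only [Torus.timeDerivWithin, Torus.partialDeriv, Torus.lineDeriv, derivWithin_fun_const, Pi.zero_apply,
      Fin.sum_univ_three, one_mul, shearU_apply, e0_zero, e0_one, e0_two, mul_one, mul_zero, zero_smul,
      deriv_const, add_zero]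
    -- the `i = 0` term: the field `(G e₀) ↦` is constant along `e₀`
    have : (fun s : ℝ => shearT (x + Torus.proj (s • EuclideanSpace.single (0 : Fin 3) (1 : ℝ))) •
        shearU (x + Torus.proj (s • EuclideanSpace.single (0 : Fin 3) (1 : ℝ)))) = fun _ => shearT x • shearU x := by
      funext s
      rw [shearU, shearU, shearT_add_proj]
    rw [this, deriv_const, add_zero]
  energy t _ x := by
    simp only [Torus.timeDerivWithin, Torus.divergence, Torus.partialDeriv, Torus.lineDeriv, derivWithin_fun_const, Pi.zero_apply,
      Fin.sum_univ_three, PiLp.smul_apply, smul_eq_mul, shearU_apply, e0_zero, e0_one, e0_two, mul_one,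
      mul_zero, deriv_const, add_zero, zero_add]
    have : (fun s : ℝ => (totalEnergyDensity 1 (shearU (x + Torus.proj (s • EuclideanSpace.single (0 : Fin 3) (1 : ℝ)))) 1 +
        hsPressure σ 1 1) * shearT (x + Torus.proj (s • EuclideanSpace.single (0 : Fin 3) (1 : ℝ)))) =
        fun _ => (totalEnergyDensity 1 (shearU x) 1 + hsPressure σ 1 1) * shearT x := by
      funext s
      rw [totalEnergyDensity, totalEnergyDensity, norm_shearU, norm_shearU, shearT_add_proj]
    rw [this, deriv_const]

end Shear



/-! ## C0. Continuity of the shear field -/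

/-- The torus shear profile is continuous (quotient lift of a continuous periodic function). [folklore] -/
theorem continuous_shearT : Continuous shearT := by
  have h : Continuous (fun a : UnitAddCircle => shearG_periodic.lift a) :=
    continuous_shearG.quotient_liftOn' _
  exact h.comp (continuous_apply 1)

/-- The shear field is continuous. [folklore] -/
theorem continuous_shearU : Continuous shearU := continuous_shearT.smul continuous_const

/-- The shear profile is at most `1` (`expNegInvGlue ≤ 1`). [folklore] -/
theorem shearG_le_one (s : ℝ) : shearG s ≤ 1 := by
  rw [shearG, expNegInvGlue]
  split_ifs with h
  · exact zero_le_one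
  · refine (Real.exp_le_one_iff.2 ?_)
    have : 0 < -Real.cos (2 * π * s) := lt_of_not_ge h
    have := inv_pos.2 this
    linarith

/-- The torus shear profile is at most `1`. [folklore] -/
theorem shearT_le_one (x : T3) : shearT x ≤ 1 := by
  rw [shearT_eq]; exact shearG_le_one _

/-- The shear field has speed at most `1`. [folklore] -/
theorem norm_shearU_le_one (x : T3) : ‖shearU x‖ ≤ 1 := by
  rw [norm_shearU]; exact shearT_le_one x

/-! ## C3a. Splitting off the first coordinate of `𝕋³`: the shear along `e₀` preserves Haar integrals -/

/-- `𝕋³ ≃ᵐ 𝕋 × 𝕋²`, coordinate `0` first. -/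
def splitT3 : T3 ≃ᵐ UnitAddCircle × (Fin 2 → UnitAddCircle) :=
  MeasurableEquiv.piFinSuccAbove (fun _ : Fin 3 => UnitAddCircle) 0

/-- Splitting off coordinate `0` preserves Haar measure. [folklore] -/
theorem measurePreserving_splitT3 : MeasurePreserving splitT3 (volume : Measure T3) (volume.prod volume) :=
  volume_preserving_piFinSuccAbove (fun _ : Fin 3 => UnitAddCircle) 0

/-- The inverse of the splitting map is `Fin.cons`. [folklore] -/
theorem splitT3_symm_apply (a : UnitAddCircle) (r : Fin 2 → UnitAddCircle) : splitT3.symm (a, r) = Fin.cons a r := by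
  simp only [splitT3, MeasurableEquiv.piFinSuccAbove_symm_apply, Fin.insertNthEquiv_zero]
  rfl

/-- Moving along `e₀` by `s` adds `s` to coordinate `0` and fixes the others. [folklore] -/
theorem cons_add_proj_smul (a : UnitAddCircle) (r : Fin 2 → UnitAddCircle) (s : ℝ) :
    (Fin.cons a r : T3) + Torus.proj (s • EuclideanSpace.single (0 : Fin 3) (1 : ℝ)) =
      Fin.cons (a + ((s : ℝ) : UnitAddCircle)) r := by
  funext i
  rw [Pi.add_apply, Torus.proj_apply]
  refine Fin.cases ?_ (fun j => ?_) i
  · simp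
  · simp

/-- **Haar integrals on `𝕋³` are invariant under shears along `e₀`** whose amplitude does not depend on the
coordinate `0`: `∫ Ψ(x + c(x) e₀) dx = ∫ Ψ(x) dx` (Fubini: coordinate `0` innermost, translation invariance of
Haar measure on the circle). [folklore] -/
theorem integral_shear {Ψ : T3 → ℝ} (hΨ : Continuous Ψ) {c : T3 → ℝ} (hc : Continuous c)
    (hcinv : ∀ (x : T3) (s : ℝ), c (x + Torus.proj (s • EuclideanSpace.single (0 : Fin 3) (1 : ℝ))) = c x) :
    ∫ x, Ψ (x + Torus.proj ((c x) • EuclideanSpace.single (0 : Fin 3) (1 : ℝ))) = ∫ x, Ψ x := by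
  have hS : Continuous fun x : T3 => x + Torus.proj ((c x) • EuclideanSpace.single (0 : Fin 3) (1 : ℝ)) :=
    continuous_id.add (Torus.continuous_proj.comp (hc.smul continuous_const))
  have hΨS : Continuous fun x : T3 => Ψ (x + Torus.proj ((c x) • EuclideanSpace.single (0 : Fin 3) (1 : ℝ))) :=
    hΨ.comp hS
  have hes : MeasurePreserving splitT3.symm ((volume : Measure UnitAddCircle).prod volume) volume :=
    measurePreserving_splitT3.symm splitT3
  -- transport both sides to `𝕋 × 𝕋²`, coordinate `0` innermost
  have htr : ∀ {F : T3 → ℝ}, Continuous F →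
      ∫ x, F x = ∫ r : Fin 2 → UnitAddCircle, ∫ a : UnitAddCircle, F (Fin.cons a r) := by
    intro F hF
    rw [← hes.integral_comp' (g := F),
      integral_prod_symm (fun p => F (splitT3.symm p))
        (hes.integrable_comp_of_integrable (integrable_of_continuous_T3 hF))]
    simp_rw [splitT3_symm_apply]
  rw [htr hΨS, htr hΨ]
  refine integral_congr_ae (ae_of_all _ fun r => ?_)
  have hcr : ∀ a : UnitAddCircle, c (Fin.cons a r) = c (Fin.cons 0 r) := by
    intro a
    obtain ⟨â, rfl⟩ := QuotientAddGroup.mk_surjective a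
    have h := hcinv (Fin.cons 0 r) â
    rw [cons_add_proj_smul, zero_add] at h
    exact h
  simp_rw [hcr, cons_add_proj_smul]
  exact integral_add_right_eq_self (μ := (volume : Measure UnitAddCircle))
    (fun a => Ψ (Fin.cons a r)) ((c (Fin.cons 0 r) : ℝ) : UnitAddCircle)


end Summit.AtomisticToContinuum.HydrodynamicLimit.Theorems.LightConeInLawIdealGas

end
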